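import Mathlib
import HarnessLib
import Summits.FinalStateConjecture.FinalStateConjecture.Theorems.LogTimeThreeAnnuliDyadicCaptureDefs
import Summits.FinalStateConjecture.FinalStateConjecture.Theorems.LogTimeThreeAnnuliDyadicCaptureRestrictionRechartAux
import Literature.Geometry.Lorentzian.KerrCollarConvergence
import Literature.Geometry.Lorentzian.KerrConvergenceProofs

/-!
# Route LogTimeThreeAnnuli · crux `DyadicCapture`, line `registered` — stub 6b: the restriction rechart

Proof of the registered stub `stub_restrictionRechart` (6b) of the skeleton of the crux
`Summit.FinalStateConjecture.FinalStateConjecture.Theses.LogTimeThreeAnnuli.DyadicCapture`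
(stmt-FinalStateConjecture-17488, line `registered`, file `Cruxes/DyadicCapture/Lines/birth.lean`).

Given an honest era system `d, R` (`IsHonestEraSystem`) of the MGHD `𝒟` with frozen `Cᵏ` convergence
(`HasFrozenConvergence`) to sub-extremal members `(Mᵢ, aᵢ)` in the REFERENCE charts, and the conclusion of
stub 6a (`stub_horizonNormalisedRestriction`: a chart time `τ₁ ≥ τ₀`, honest radii `R'ᵢ` w.r.t. `(Mᵢ, aᵢ)`
dominated through `R'ᵢ + |aᵢ| + |d.spin i| ≤ max Rᵢ ρ₀`, the frozen exteriors inside the reference domains,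
and the causal clauses of the would-be restricted system in
`O'' = exteriorOf 𝒟 (restrictedCharted … τ₁)`), we CONSTRUCT the settled system (`IsSettledSystem`):
`O' := O''` and the `C²` `FinalStateDecomposition d'` with the frozen masses/spins, the same motions, late
time `τ₁`, hole charts `d.chart i ∘ ι` restricted to the frozen exteriors
`boostedKerrExterior Λᵢ cᵢ Mᵢ aᵢ`, the same flat chart, and excision radii enlarged by `|aᵢ| + |d.spin i|`.
Every field and clause is bookkeeping over `Theorems/LogTimeThreeAnnuliDyadicCaptureRestrictionRechartAux.lean`:
late charts re-based to `τ₁` and `O''` (`restrictionRechart_isLateChart_of_le`, `IsLateChart.comp_inclusion`);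
fixed-slab and growing-slab convergence at `k = 2` from the frozen convergence through the slab comparison
`{r_{aᵢ} ≤ ρ} ⊆ {r_{d.spin i} ≤ ρ + |aᵢ| + |d.spin i|}` (`restrictionRechart_tendsto_truncDeviationCk_comp_inclusion`,
`…_max`, `…_of_le`); separation and the flat-domain clause by the same radius comparison; the covector clause
by the chain rule along the inclusion; `charted`, the initial slabs and the certified sets of `d'` are the
`restricted…` sets of the Defs file, so the causal clauses are exactly those supplied by 6a.
Sources: Dafermos–Luk arXiv:1710.01722, Conjecture 1 (b)–(c); DHRT arXiv:2104.08222, §1; Klainerman–Szeftel,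
AMS-210, §1.2 (orbital versus asymptotic stability in a fixed gauge).
-/

-- the `Summit.FinalStateConjecture.FinalStateConjecture.…` namespace repeats the summit = sub-problem
-- segment (D-0017); deliberate.
set_option linter.dupNamespace false

noncomputable section

namespace Summit.FinalStateConjecture.FinalStateConjecture.Theorems

open Literature.Geometry.Lorentzian
open scoped Topology Manifold ENNReal ContDiff
open Filter Set TopologicalSpace

/-- **Stub 6b — the restriction rechart** of the line `registered` of the crux `DyadicCapture`: under the
conclusion of stub 6a, restricting the reference hole charts of an honest era system with frozen
convergence to the frozen exteriors (`d.chart i ∘ Opens.inclusion`, common late time `τ₁`, masses/spins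
`(Mᵢ, aᵢ)`, excision radii enlarged by `|aᵢ| + |d.spin i|`, flat chart verbatim) is a `C²`
`FinalStateDecomposition d'` of `O' = exteriorOf 𝒟 (restrictedCharted … τ₁)` which is a settled system
(`IsSettledSystem`). Dafermos–Luk arXiv:1710.01722, Conjecture 1 (b)–(c). [cite: DafermosLuk2017, Conjecture 1 (b)–(c)] -/
theorem stub_restrictionRechart : ∀ (X : Type) [TopologicalSpace X] [ChartedSpace E3 X] [IsManifold (𝓡 3) ((⊤ : ℕ∞) : WithTop ℕ∞) X] [T2Space X] [SecondCountableTopology X] [ConnectedSpace X], ∀ D ∈ admissibleVacuumData X, ∀ 𝒟 : VacuumCauchyDevelopment D, 𝒟.IsMaximal → Summit.FinalStateConjecture.HasCompleteNullInfinity 𝒟.toCauchyDevelopment → ∀ (O : Set 𝒟.carrier) (d : QuasiFinalStateDecomposition 𝒟.toSpacetime O 2 ⊤) (R : Fin d.N → ℝ → ℝ) (M a : Fin d.N → ℝ), Summit.FinalStateConjecture.FinalStateConjecture.Theorems.IsHonestEraSystem 𝒟 O d R → (∀ i : Fin d.N, 0 < M i ∧ |a i| < M i) → Summit.FinalStateConjecture.FinalStateConjecture.Theorems.HasFrozenConvergence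 𝒟.toSpacetime O d R M a → (∃ (τ₁ : ℝ) (R' : Fin d.N → ℝ → ℝ), d.τ₀ ≤ τ₁ ∧ (∀ i : Fin d.N, (boostedKerrExterior (d.motion i).1 (d.motion i).2 (M i) (a i) : Set E4) ⊆ (boostedKerrExterior (d.motion i).1 (d.motion i).2 (d.mass i) (d.spin i) : Set E4)) ∧ (∀ i : Fin d.N, Filter.Tendsto (R' i) Filter.atTop Filter.atTop ∧ ∀ τ : ℝ, max (Kerr.rPlus (M i) (a i)) 0 + 1 ≤ R' i τ) ∧ (∀ i : Fin d.N, ∃ ρ₀ : ℝ, ∀ τ : ℝ, R' i τ + |a i| + |d.spin i| ≤ max (R i τ) ρ₀) ∧ (∀ i : Fin d.N, Summit.FinalStateConjecture.FinalStateConjecture.Theorems.restrictedRegion 𝒟.toSpacetime O d M a τ₁ i ⊆ Summit.FinalStateConjecture.exteriorOf 𝒟.toCauchyDevelopment (Summit.FinalStateConjecture.FinalStateConjecture.Theorems.restrictedCharted 𝒟.toSpacetime O d M a τ₁)) ∧ d.flatChart '' (Minkowski.backgroundOn d.flatDomain).lateRegion τ₁ ⊆ Summit.FinalStateConjecture.exteriorOf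 𝒟.toCauchyDevelopment (Summit.FinalStateConjecture.FinalStateConjecture.Theorems.restrictedCharted 𝒟.toSpacetime O d M a τ₁) ∧ Summit.FinalStateConjecture.RaysStayInClosure 𝒟.toCauchyDevelopment (Summit.FinalStateConjecture.exteriorOf 𝒟.toCauchyDevelopment (Summit.FinalStateConjecture.FinalStateConjecture.Theorems.restrictedCharted 𝒟.toSpacetime O d M a τ₁)) ∧ Summit.FinalStateConjecture.exteriorOf 𝒟.toCauchyDevelopment (Summit.FinalStateConjecture.FinalStateConjecture.Theorems.restrictedCharted 𝒟.toSpacetime O d M a τ₁) \ Summit.FinalStateConjecture.FinalStateConjecture.Theorems.restrictedCharted 𝒟.toSpacetime O d M a τ₁ ⊆ 𝒟.metric.causalPast 𝒟.timeOrientation (Summit.FinalStateConjecture.FinalStateConjecture.Theorems.restrictedInitialSlabs 𝒟.toSpacetime O d M a τ₁) ∧ (∀ τ₂ : ℝ, τ₁ < τ₂ → Summit.FinalStateConjecture.exteriorOf 𝒟.toCauchyDevelopment (Summit.FinalStateConjecture.FinalStateConjecture.Theorems.restrictedCharted 𝒟.toSpacetime O d M a τ₁) \ Summit.FinalStateConjecture.FinalStateConjecture.Theorems.restrictedCertifiedLate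 𝒟.toSpacetime O d M a R' τ₂ ⊆ 𝒟.metric.causalPast 𝒟.timeOrientation (Summit.FinalStateConjecture.FinalStateConjecture.Theorems.restrictedCertifiedSlab 𝒟.toSpacetime O d M a R' τ₂))) → ∃ (O' : Set 𝒟.carrier) (d' : FinalStateDecomposition 𝒟.toSpacetime O' 2), Summit.FinalStateConjecture.FinalStateConjecture.Theorems.IsSettledSystem 𝒟 O' d' := by
  intro X _ _ _ _ _ _ D _ 𝒟 _ _ O d R M a hera hsub hfro h6a
  obtain ⟨-, -, -, -, horth, hcov, hflat0, hflat⟩ := hera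
  obtain ⟨hfix, hgrow⟩ := hfro
  obtain ⟨τ₁, R', hτ₁, hinc, hR', hmargin, himg, himg0, hrays', hcov', hexh'⟩ := h6a
  set O'' : Set 𝒟.carrier := Summit.FinalStateConjecture.exteriorOf 𝒟.toCauchyDevelopment
    (restrictedCharted 𝒟.toSpacetime O d M a τ₁)
  have hle : ∀ i : Fin d.N, boostedKerrExterior (d.motion i).1 (d.motion i).2 (M i) (a i) ≤
      boostedKerrExterior (d.motion i).1 (d.motion i).2 (d.mass i) (d.spin i) :=
    fun i ↦ SetLike.coe_subset_coe.1 (hinc i)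
  -- (1) the restricted hole charts are late-time charts into `O''` after `τ₁`
  have hlate : ∀ i : Fin d.N, 𝒟.toSpacetime.IsLateChart
      (boostedKerrBackground (d.motion i).1 (d.motion i).2 (M i) (a i)) O'' τ₁
      (d.chart i ∘ Opens.inclusion (hle i)) := fun i ↦
    restrictionRechart_isLateChart_of_le
      ((d.isLateChart i).comp_inclusion
        (B' := boostedKerrBackground (d.motion i).1 (d.motion i).2 (M i) (a i)) (hle i) fun _ ↦ rfl)
      (continuous_time_boostedKerrBackground _ _ _ _) hτ₁
      ((restrictionRechart_image_lateRegion d M a i (hle i) τ₁).subset.trans (himg i))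
  -- (2) near-zone convergence at `k = 2` on every fixed slab of the frozen background
  have htrunc : ∀ (i : Fin d.N) (ρ : ℝ), Tendsto (fun τ ↦ 𝒟.toSpacetime.truncDeviationCk
      (boostedKerrBackground (d.motion i).1 (d.motion i).2 (M i) (a i))
      (d.chart i ∘ Opens.inclusion (hle i)) 2 ρ τ) atTop (𝓝 0) := fun i ρ ↦
    restrictionRechart_tendsto_truncDeviationCk_comp_inclusion (d.motion i).1 (d.motion i).2 (M i)
      (a i) (d.spin i) (r := fun _ ↦ ρ) (hfix i 2 (ρ + |a i| + |d.spin i|))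
      (d.isLateChart i).contMDiff (hle i) (fun _ ↦ rfl) (fun _ ↦ rfl) (fun _ ↦ rfl)
  -- (3) separation of the restricted near zones
  obtain ⟨C, hCi⟩ : ∃ C : ℝ, ∀ i : Fin d.N, |a i| ≤ C :=
    ⟨∑ j : Fin d.N, (|a j| + |d.spin j|), fun i ↦
      (le_add_of_nonneg_right (abs_nonneg (d.spin i))).trans
        (Finset.single_le_sum (f := fun j ↦ |a j| + |d.spin j|)
          (fun j _ ↦ add_nonneg (abs_nonneg _) (abs_nonneg _)) (Finset.mem_univ i))⟩
  have hdisj : ∀ ρ : ℝ, ∃ τ : ℝ, Pairwise (Function.onFun Disjoint fun i ↦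
      (d.chart i ∘ Opens.inclusion (hle i)) ''
        (boostedKerrBackground (d.motion i).1 (d.motion i).2 (M i) (a i)).truncLateRegion τ ρ) := by
    intro ρ
    obtain ⟨τ, hτ⟩ := d.exists_pairwise_disjoint (ρ + C)
    refine ⟨τ, fun i j hij ↦ Disjoint.mono ?_ ?_ (hτ hij)⟩
    · exact restrictionRechart_image_truncLateRegion_subset _ _ _ _ _ _ (hle i) (d.chart i)
        (by linarith [hCi i])
    · exact restrictionRechart_image_truncLateRegion_subset _ _ _ _ _ _ (hle j) (d.chart j)
        (by linarith [hCi j])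
  -- (4) the enlarged excision radii and the flat-domain clause
  have hexc : ∀ i : Fin d.N,
      Tendsto (fun t ↦ (d.excision i t + (|a i| + |d.spin i|)) / t) atTop (𝓝 0) := by
    intro i
    have h1 := d.tendsto_excision_div i
    have h2 : Tendsto (fun t : ℝ ↦ (|a i| + |d.spin i|) / t) atTop (𝓝 0) :=
      tendsto_const_nhds.div_atTop tendsto_id
    have h3 := h1.add h2
    rw [add_zero] at h3
    exact h3.congr fun t ↦ (add_div _ _ _).symm
  have hfd : {x : E4 | τ₁ < x 0 ∧ ∀ i : Fin d.N, d.excision i (x 0) + (|a i| + |d.spin i|) <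
      Kerr.radius (a i) (poincareInv (d.motion i).1 (d.motion i).2 x)} ⊆ (d.flatDomain : Set E4) := by
    intro x hx
    obtain ⟨hx₁, hx₂⟩ := hx
    refine d.setOf_lt_excision_subset_flatDomain ⟨lt_of_le_of_lt hτ₁ hx₁, fun i ↦ ?_⟩
    have h1 := hx₂ i
    have h2 := restrictionRechart_radius_le_radius_add_abs (d.spin i) (a i)
      (poincareInv (d.motion i).1 (d.motion i).2 x)
    have h3 := abs_nonneg (a i)
    linarith
  -- (5) the flat chart, re-based to `τ₁` and `O''`
  have hlf : 𝒟.toSpacetime.IsLateChart (Minkowski.backgroundOn d.flatDomain) O'' τ₁ d.flatChart :=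
    restrictionRechart_isLateChart_of_le d.isLateChart_flat (Minkowski.continuous_time_backgroundOn _)
      hτ₁ himg0
  -- (6) the covering clause at `τ₁`
  have hcovd : O'' \ ((⋃ i, (d.chart i ∘ Opens.inclusion (hle i)) ''
        (boostedKerrBackground (d.motion i).1 (d.motion i).2 (M i) (a i)).lateRegion τ₁) ∪
        d.flatChart '' (Minkowski.backgroundOn d.flatDomain).lateRegion τ₁) ⊆
      𝒟.metric.causalPast 𝒟.timeOrientation ((⋃ i, (d.chart i ∘ Opens.inclusion (hle i)) ''
        (boostedKerrBackground (d.motion i).1 (d.motion i).2 (M i) (a i)).timeSlab τ₁) ∪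
        d.flatChart '' (Minkowski.backgroundOn d.flatDomain).timeSlab τ₁) := by
    have e1 : (⋃ i, (d.chart i ∘ Opens.inclusion (hle i)) ''
          (boostedKerrBackground (d.motion i).1 (d.motion i).2 (M i) (a i)).lateRegion τ₁) ∪
          d.flatChart '' (Minkowski.backgroundOn d.flatDomain).lateRegion τ₁ =
        restrictedCharted 𝒟.toSpacetime O d M a τ₁ := by
      rw [union_comm]
      exact restrictionRechart_charted_eq d M a hle τ₁
    have e2 : (⋃ i, (d.chart i ∘ Opens.inclusion (hle i)) ''
          (boostedKerrBackground (d.motion i).1 (d.motion i).2 (M i) (a i)).timeSlab τ₁) ∪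
          d.flatChart '' (Minkowski.backgroundOn d.flatDomain).timeSlab τ₁ =
        restrictedInitialSlabs 𝒟.toSpacetime O d M a τ₁ := by
      rw [union_comm]
      exact restrictionRechart_initialSlabs_eq d M a hle τ₁
    rw [e1, e2]
    exact hcov'
  -- (7) the covector orientation clause on the restricted slabs
  have hcovec : ∀ (i : Fin d.N) (ρ : ℝ), ∀ᶠ τ in atTop, ∀ x ∈ (boostedKerrBackground (d.motion i).1
      (d.motion i).2 (M i) (a i)).truncTimeSlab ρ τ, ∀ w : E4,
      𝒟.timeOrientation.IsFutureDirected
        (mfderiv 𝓘(ℝ, E4) (𝓡 4) (d.chart i ∘ Opens.inclusion (hle i)) x w) →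
        0 < ((d.motion i).1 : E4 ≃L[ℝ] E4).symm w 0 := by
    intro i ρ
    filter_upwards [hcov i (ρ + |a i| + |d.spin i|)] with τ hτ x hx w hw
    obtain ⟨hx₁, hx₂⟩ := hx
    have h1 := restrictionRechart_radius_le_radius_add_abs (a i) (d.spin i)
      (poincareInv (d.motion i).1 (d.motion i).2 x.1)
    have h2 : Kerr.radius (a i) (poincareInv (d.motion i).1 (d.motion i).2 x.1) ≤ ρ := hx₂
    have h3 : poincareInv (d.motion i).1 (d.motion i).2 x.1 0 = τ := hx₁
    have h4 : Kerr.radius (d.spin i) (poincareInv (d.motion i).1 (d.motion i).2 x.1) ≤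
        ρ + |a i| + |d.spin i| := by linarith [abs_nonneg (d.spin i)]
    have hmem : Opens.inclusion (hle i) x ∈
        (d.background i).truncTimeSlab (ρ + |a i| + |d.spin i|) τ := ⟨h3, h4⟩
    have hdiff : MDifferentiableAt 𝓘(ℝ, E4) (𝓡 4) (d.chart i) (Opens.inclusion (hle i) x) :=
      ((d.isLateChart i).contMDiff _).mdifferentiableAt (by simp)
    rw [restrictionRechart_mfderiv_comp_inclusion_apply (hle i) x hdiff w] at hw
    exact hτ (Opens.inclusion (hle i) x) hmem w hw
  -- (8) growing-slab convergence at `k = 2` for the radii `R'`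
  have hgrow' : ∀ i : Fin d.N, Tendsto (fun τ ↦ 𝒟.toSpacetime.truncDeviationCk
      (boostedKerrBackground (d.motion i).1 (d.motion i).2 (M i) (a i))
      (d.chart i ∘ Opens.inclusion (hle i)) 2 (R' i τ) τ) atTop (𝓝 0) := by
    intro i
    obtain ⟨ρ₀, hρ₀⟩ := hmargin i
    have h1 := restrictionRechart_tendsto_truncDeviationCk_max (hgrow i 2) (hfix i 2 ρ₀)
    have h2 := restrictionRechart_tendsto_truncDeviationCk_of_le
      (R' := fun τ ↦ R' i τ + |a i| + |d.spin i|) hρ₀ h1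
    exact restrictionRechart_tendsto_truncDeviationCk_comp_inclusion (d.motion i).1 (d.motion i).2
      (M i) (a i) (d.spin i) (r := R' i) h2 (d.isLateChart i).contMDiff (hle i)
      (fun _ ↦ rfl) (fun _ ↦ rfl) (fun _ ↦ rfl)
  -- the recharted system
  let d' : FinalStateDecomposition 𝒟.toSpacetime O'' 2 :=
    { N := d.N
      mass := M
      spin := a
      mass_pos := fun i ↦ (hsub i).1
      abs_spin_le_mass := fun i ↦ (hsub i).2.le
      motion := d.motion
      τ₀ := τ₁
      chart := fun i ↦ d.chart i ∘ Opens.inclusion (hle i)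
      isLateChart := hlate
      tendsto_truncDeviationCk := htrunc
      exists_pairwise_disjoint := hdisj
      excision := fun i t ↦ d.excision i t + (|a i| + |d.spin i|)
      tendsto_excision_div := hexc
      flatDomain := d.flatDomain
      setOf_lt_excision_subset_flatDomain := hfd
      flatChart := d.flatChart
      isLateChart_flat := hlf
      tendsto_deviationCk_flat := hflat 2
      diff_subset_causalPast := hcovd }
  -- its derived sets are the restricted sets of the Defs file
  have hch : d'.charted = restrictedCharted 𝒟.toSpacetime O d M a τ₁ :=
    restrictionRechart_charted_eq d M a hle τ₁
  have hcl : ∀ τ₂ : ℝ, Summit.FinalStateConjecture.certifiedLate d' R' τ₂ =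
      restrictedCertifiedLate 𝒟.toSpacetime O d M a R' τ₂ := fun τ₂ ↦
    restrictionRechart_certifiedLate_eq d M a hle R' τ₂
  have hcs : ∀ τ₂ : ℝ, Summit.FinalStateConjecture.certifiedSlab d' R' τ₂ =
      restrictedCertifiedSlab 𝒟.toSpacetime O d M a R' τ₂ := fun τ₂ ↦
    restrictionRechart_certifiedSlab_eq d M a hle R' τ₂
  refine ⟨O'', d', ?_⟩
  rw [isSettledSystem_iff]
  refine ⟨fun i ↦ (hsub i).2, ?_, hrays', ⟨R', hR', hgrow', fun τ₂ hτ₂ ↦ ?_⟩, horth, hcovec, hflat0⟩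
  · rw [hch]
  · rw [hcl τ₂, hcs τ₂]
    exact hexh' τ₂ hτ₂

end Summit.FinalStateConjecture.FinalStateConjecture.Theorems

end
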